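import Summits.QuantumFields.YangMills.Theorems.BalabanUVNodesN15KingModelTreeGraphEngineRate
import Summits.QuantumFields.YangMills.Theorems.BalabanUVNodesN15KingModelGraphReplacementKing
import Summits.QuantumFields.YangMills.Theorems.BalabanUVNodesN15KingModelPowerCountingLetters
import Summits.QuantumFields.YangMills.Theorems.BalabanUVNodesN15KingModelSlicesTelescoped

/-!
# BalabanUVNodes ∕ N15 — THE KING-MODEL RUNG (PART Ι-c): THE LINE-SUM LETTERS OF PROPOSITION 3.6's POWER COUNTING, BY NAME AT `A = 0` —
# (3.63)∕(3.73) summed over one vertex by (3.68) («we get altogether the exponent D(H₁)»), the slice sums (3.69)–(3.70), and the FULL `A = 0` propagator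
# `G^η_k = Σ_{j<k} G^η_{(j)}` (2.17) as a line kernel — the letters the tree-graph engine (parts Ι-a∕Ι-b) consumes in part Ι-d (Track A, DAG node N15 = NE2; FAN-OUT v1.1 §N15 s3 «KING-MODEL RUNG … NE2's analogue DECIDED in the model»)

HONEST FRAMING.  Count-neutral (cell `pub-ymgap`, seat `pub-ymgap-dag-n15-e` g26; `--supports stmt-QuantumFields-27366 --as helper` = K3⁸
`SpineGivenEndpointR13SepCoPHV`).  TEMPLATE LITERATURE: C. King, *The U(1) Higgs model. I. The continuum limit*, Commun. Math. Phys. **102** (1986) 649–677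
[King1986], proof of Proposition 3.6 pp. 663–665, for KING's OWN `A = 0` PROPAGATOR (2.13)∕(2.17) — Propositions 3.7∕3.9 BY NAME on the rung's records
(parts Ρ∕Χ, merged by part Ω₂ `king_props37_38_39_commonConstants`), (2.17) EXACT (part Χ-e `king217_kingSliceKernels`, `dGsum_kingSliceKernels`), (3.68) on
the torus (part Μ `sum_eta_pow_mul_exp_le`), (3.69)–(3.70) (part Μ `sliceWeight_sum_le`).  These are the hypotheses of the tree-graph engine (parts Ι-a∕Ι-b)
for lines carrying the FULL propagator; part Ι-d assembles Prop. 3.6 for tree graphs.  King's U(1)∕`A = 0` MODEL; NOT Bałaban's non-abelian `G(U)` of [B9];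
NOT a node discharge; nothing continuum ∕ ℝ⁴ ∕ OS ∕ mass-gap ∕ Clay.  0 `sorry`; standard axioms.
THE PRINT.  p. 663 [PDF 15]: *«Every internal line in H carries a propagator G_k, G_k(□) or one of their derivatives, which may be decomposed by writing
G_k = Σ_{j=0}^{k−1} G_{(j)}, see (2.17). … We divide the internal lines into two sets S and S^c; in S all integers are zero or positive, while in S^c all integers
are negative.»*; p. 664 [PDF 16]: *«We then sum over y, giving Σ_y exp[−δ₁L^{k−j_{l(1)}}|x − y|] ≤ C[L^{k−j_{l(1)}}]^{−d}. (3.68) Combining this factor with the power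
of L^{j_{l(1)}−k} already present from the propagator on l(1) … we get altogether the exponent D(H₁). … (3.69) … (3.70) … For γ small enough, D(H_i) − γ > 0 … The
final sum over j is then bounded by C … and (3.70) gives L^{−γk}.»*; p. 665: *«we see that the degrees of some subgraphs have been reduced by γ»*.
WHAT THIS FILE PROVES (namespace `…N15KingModelRung.Curved`; `D = kingSliceKernels L k e_M M a m²` the `k`-level datum on `T_η = Tor (fine (L^k) M)`, `η = L^{−k}`,
slice lengths `L^jη`; `T = kingSlicesTwoSpacing L k n e_M M a m²` the two-spacing record; weights `η^{d+1}`, `η′^{d+1}`).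
* §1 `sliceLine D j κ` (`G_(j)`∕`∂_μG_(j)`; part Η-b's `loLine`∕`hiLine` are `sliceLine` of `T.lo`∕`T.hi`), `lineDeg κ` (`= 2`∕`1`: THE DEGREE OF THE ONE-LINE SUBGRAPH,
  `lineExp κ + (d+1)`), `c368 d δ₀ = (2(1 + (d+1)∕δ₀))^{d+1}` ((3.68)'s constant).
* §2 ★ `kingGLine L M a m² k κ` — THE FULL `A = 0` LINE KERNEL (`constrainedProp (L^k) M a_k (L^k)² m²` = King's `G^η_k`, (2.13), for `κ = none`; its forward
  η-gradient for `κ = some μ`); ★ `kingGLine_eq_sum_sliceLine` — **(2.17)** for both kinds (part Χ-e).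
* §3 ★ `lineSum_profile_le` ((3.68): `Σ_y η^{d+1}·C(L^jη)^e e^{−δ₀|x−y|∕(L^jη)} ≤ C·c368·(L^jη)^{e+d+1}`); ★ `lineSum_sliceLine_le` (⇐ `Prop37PrintedAt`:
  `≤ C·c368·(L^jη)^{lineDeg κ}`); ★ `lineSum_sliceRate_le` (⇐ `Prop39PrintedAt` (3.73) + the re-pairing of the vertex sum, part Ι-b `sum_repaired`:
  `Σ_{y′} η′^{d+1}|G^{η′}_{(j)}(x′, y′) − G^η_{(j)}(x, y)| ≤ L^{−γk}·C·c368·(L^jη)^{lineDeg κ − γ}` — «the degrees … reduced by γ»).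
* §4 `slice_rpow_eq`, `sliceSum_le` ((3.69): `Σ_{j<k}(L^jη)^D ≤ (1 − L^{−D})^{−1}`), `finestSum_le` ((3.70), the `S^c` slices `i < n` of the fine run:
  `Σ_{i<n}(L^iη′)^D ≤ (1 − L^{−D})^{−1}·L^{−D(k+1)}`), `geomConst_le_two`, `geomConst_mono`.
The full propagator's uniform line sum and its two-lattice line-sum rate (the `S`∕`S^c` split) and the tree theorem are part Ι-d `…KingModelTreeGraphKing`.
HONEST SCOPE.  (a) King's `A = 0` model (U(1) print), cubes `2L^{e_M}`, `k ≥ 1`; `Prop37PrintedAt` (both runs) and `Prop39PrintedAt` are discharged by part Ω₂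
in part Ι-d.  (b) Lines `G`, `∂_μG` only (degrees 2, 1); `∂G∂*` (degree 0, log-divergent slice sum) and the contour∕Hölder kernels are not placed.  (c) Letters only.  Locators: [King1986] (2.13)–(2.17) p.653, (3.59)–(3.61) p.663, Prop. 3.7 (3.63) p.663, (3.66)–(3.70) p.664, (3.73) p.665.
-/

noncomputable section

namespace Summit.QuantumFields.YangMills.BalabanUVNodes.N15KingModelRung.Curved

open scoped BigOperators
open Finset
open Literature.MathematicalPhysics.QuantumFieldTheory.Balaban1983to89.B5Prop11Plancherel (Tor fine unitVec)
open Literature.MathematicalPhysics.QuantumFieldTheory.King1986 (aK)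
open Literature.MathematicalPhysics.QuantumFieldTheory.King1986.Torus (tdistT tdistT_nonneg constrainedProp)
open Literature.MathematicalPhysics.QuantumFieldTheory.King1986.SlicePropagator (SliceKernels TwoSpacing Prop37PrintedAt Prop39PrintedAt)
open Literature.MathematicalPhysics.QuantumFieldTheory.King1986.ContinuumLimit (eps)
open Summit.QuantumFields.YangMills.BalabanUVNodes.N15KingModelRung.Graph

variable {d : ℕ} (L : ℕ) [NeZero L]

/-! ## §1 Line kernels of a slice datum; the degree of a one-line subgraph; (3.68)'s constant -/

section Letters

/-- **the line kernel of slice `j` and kind `κ`** of a slice datum: `G_(j)` (`κ = none`) or `∂_μG_(j)` (`κ = some μ`). [cite: King1986, (2.17) p.653, (3.59) p.663] -/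
def sliceLine {dd : ℕ} (D : SliceKernels dd) (j : ℕ) : Option (Fin dd) → D.S → D.S → ℝ
  | none => D.G j
  | some μ => D.dG j μ

omit [NeZero L] in
/-- part Η-b's coarse line kernel is the `sliceLine` of `T.lo`. [folklore] -/
theorem loLine_eq_sliceLine {dd : ℕ} (T : TwoSpacing dd) (j : ℕ) (κ : Option (Fin dd)) : loLine T j κ = sliceLine T.lo j κ := by
  cases κ <;> rfl

omit [NeZero L] in
/-- part Η-b's fine line kernel is the `sliceLine` of `T.hi`. [folklore] -/
theorem hiLine_eq_sliceLine {dd : ℕ} (T : TwoSpacing dd) (j : ℕ) (κ : Option (Fin dd)) : hiLine T j κ = sliceLine T.hi j κ := by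
  cases κ <;> rfl

/-- **THE DEGREE OF THE ONE-LINE SUBGRAPH** `{ℓ and its two vertices}`: the power of `L^jη` left after the vertex sum (3.68) — `2` for a `G`-line, `1` for a
`∂_μG`-line (`(2 − d) + d`, `(1 − d) + d`). [cite: King1986, (3.66)–(3.68) p.664 («we get altogether the exponent D(H₁)»)] -/
def lineDeg (dd : ℕ) : Option (Fin dd) → ℝ
  | none => 2
  | some _ => 1

omit [NeZero L] in
/-- `lineExp κ + d = lineDeg κ` (the vertex sum (3.68) adds `d` to the exponent of (3.63)). [cite: King1986, (3.68) p.664] -/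
theorem lineExp_add_dim {dd : ℕ} (κ : Option (Fin dd)) : lineExp dd κ + (dd : ℝ) = lineDeg dd κ := by
  cases κ <;> simp only [lineExp, lineDeg] <;> ring

omit [NeZero L] in
/-- `1 ≤ lineDeg κ ≤ 2` — both kinds have POSITIVE degree (no renormalisation needed for `G`, `∂G` lines). [cite: King1986, (3.66) p.664] -/
theorem one_le_lineDeg {dd : ℕ} (κ : Option (Fin dd)) : (1 : ℝ) ≤ lineDeg dd κ ∧ lineDeg dd κ ≤ 2 := by
  cases κ <;> simp only [lineDeg] <;> norm_num

/-- **(3.68)'s constant** `(2(1 + (d+1)∕δ₀))^{d+1}` (part Μ `sum_eta_pow_mul_exp_le`). [cite: King1986, (3.68) p.664] -/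
def c368 (d : ℕ) (δ₀ : ℝ) : ℝ := (2 * (1 + ((d + 1 : ℕ) : ℝ) / δ₀)) ^ (d + 1)

omit [NeZero L] in
/-- positivity of (3.68)'s constant. [folklore] -/
theorem c368_pos (d : ℕ) {δ₀ : ℝ} (hδ₀ : 0 < δ₀) : 0 < c368 d δ₀ := by
  unfold c368; positivity

end Letters

/-! ## §2 The full `A = 0` line kernel and (2.17) -/

section FullLine

/-- ★ **THE FULL `A = 0` LINE KERNEL ON `T_η = Tor (fine (L^k) M)`**: King's `G^η_k = constrainedProp (L^k) M a_k (L^k)² m²` ((2.13); [Ba 4] (1.6) at `A = 0`,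
continuum units) for `κ = none`, and its forward η-gradient `∂^η_μG^η_k(x, y) = L^k·(G^η_k(x + e_μ, y) − G^η_k(x, y))` for `κ = some μ` — the propagators
the internal lines of `E^{(k)}(H)` carry. [cite: King1986, (2.13) p.653, p.663 («Every internal line in H carries a propagator G_k … or one of their derivatives»)] -/
def kingGLine (M : Fin (d + 1) → ℕ) [∀ μ, NeZero (M μ)] (a msq : ℝ) (k : ℕ) :
    Option (Fin (d + 1)) → Tor (fine (L ^ k) M) → Tor (fine (L ^ k) M) → ℝ
  | none => fun x y => constrainedProp (L ^ k) M (aK a L k) (((L ^ k : ℕ) : ℝ) ^ 2) msq x y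
  | some μ => fun x y => (L : ℝ) ^ k *
      (constrainedProp (L ^ k) M (aK a L k) (((L ^ k : ℕ) : ℝ) ^ 2) msq (x + unitVec (fine (L ^ k) M) μ) y
        - constrainedProp (L ^ k) M (aK a L k) (((L ^ k : ℕ) : ℝ) ^ 2) msq x y)

/-- ★ **(2.17) FOR BOTH KINDS**: `G^η_k(x, y) = Σ_{j<k} G^η_{(j)}(x, y)` and `∂^η_μG^η_k(x, y) = Σ_{j<k} ∂^η_μG^η_{(j)}(x, y)` for the datum's slices (part Χ-e
`king217_kingSliceKernels`, `dGsum_kingSliceKernels`). [cite: King1986, (2.17) p.653, p.663 («which may be decomposed by writing G_k = Σ_{j=0}^{k−1} G_{(j)}»)] -/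
theorem kingGLine_eq_sum_sliceLine (hL : 2 ≤ L) {a : ℝ} (ha : 0 < a) {k eM : ℕ} (hk : 1 ≤ k) (M : Fin (d + 1) → ℕ) [∀ μ, NeZero (M μ)]
    (hM : ∀ μ, M μ = 2 * L ^ eM) {msq : ℝ} (hmsq : 0 < msq) (κ : Option (Fin (d + 1))) (x y : Tor (fine (L ^ k) M)) :
    kingGLine L M a msq k κ x y = ∑ j ∈ Finset.range k, sliceLine (kingSliceKernels L k eM M hM hk a msq) j κ x y := by
  rcases κ with _ | μ
  · exact (king217_kingSliceKernels L hL ha hk M hM hmsq x y).symm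
  · exact (dGsum_kingSliceKernels L hL ha hk M hM hmsq μ x y).symm

end FullLine

/-! ## §3 One vertex summed: the profile by (3.68), the slice by Prop. 3.7, the slice's rate by Prop. 3.9 -/

section OneVertex

/-- ★ **THE (3.63)∕(3.73)-PROFILE SUMMED OVER ONE VERTEX BY (3.68)**: for a slice length `s = L^jη` (`η = L^{−k}`) and any real exponent `e`,
`Σ_y η^{d+1}·C·s^e·exp[−δ₀s^{−1}|x − y|] ≤ C·c368·s^{e + (d+1)}` — King p. 664: *«We then sum over y, giving (3.68) … Combining this factor with the power of
L^{j−k} already present from the propagator … we get altogether the exponent D(H₁)»*. [cite: King1986, (3.68) p.664] -/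
theorem lineSum_profile_le (hL : 1 ≤ L) {C δ₀ : ℝ} (hC : 0 ≤ C) (hδ₀ : 0 < δ₀) (k j : ℕ) (M : Fin (d + 1) → ℕ) [∀ μ, NeZero (M μ)]
    (e : ℝ) (x : Tor (fine (L ^ k) M)) :
    ∑ y, (((L : ℝ) ^ k)⁻¹) ^ (d + 1) * (C * ((L : ℝ) ^ j * eps L k) ^ e
        * Real.exp (-(δ₀ * ((L : ℝ) ^ j * eps L k)⁻¹ * (tdistT (fine (L ^ k) M) x y / (L : ℝ) ^ k))))
      ≤ C * c368 d δ₀ * ((L : ℝ) ^ j * eps L k) ^ (e + ((d + 1 : ℕ) : ℝ)) := by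
  have hL0 : (0 : ℝ) < L := by exact_mod_cast (show 0 < L by omega)
  have hs : (L : ℝ) ^ j * eps L k = (L : ℝ) ^ j / (L : ℝ) ^ k := by
    show (L : ℝ) ^ j * ((L : ℝ) ^ k)⁻¹ = _
    rw [div_eq_mul_inv]
  have hspos : 0 < (L : ℝ) ^ j * eps L k := by rw [hs]; positivity
  have hexp : ∀ y, Real.exp (-(δ₀ * ((L : ℝ) ^ j * eps L k)⁻¹ * (tdistT (fine (L ^ k) M) x y / (L : ℝ) ^ k)))
      = Real.exp (-(δ₀ * tdistT (fine (L ^ k) M) x y / (L : ℝ) ^ j)) := by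
    intro y
    rw [hs, sliceWeight_eq hL0, mul_div_assoc]
  have hsum := sum_eta_pow_mul_exp_le L k j M hL hδ₀ (χ := fun _ => (1 : ℝ)) (fun _ => le_rfl) x
  calc ∑ y, (((L : ℝ) ^ k)⁻¹) ^ (d + 1) * (C * ((L : ℝ) ^ j * eps L k) ^ e
          * Real.exp (-(δ₀ * ((L : ℝ) ^ j * eps L k)⁻¹ * (tdistT (fine (L ^ k) M) x y / (L : ℝ) ^ k))))
      = C * ((L : ℝ) ^ j * eps L k) ^ e
          * ∑ y, (((L : ℝ) ^ k)⁻¹) ^ (d + 1) * (1 : ℝ) * Real.exp (-(δ₀ * tdistT (fine (L ^ k) M) x y / (L : ℝ) ^ j)) := by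
        rw [mul_sum]
        refine sum_congr rfl fun y _ => ?_
        rw [hexp y]; ring
    _ ≤ C * ((L : ℝ) ^ j * eps L k) ^ e * ((2 * (1 + ((d + 1 : ℕ) : ℝ) / δ₀)) ^ (d + 1) * ((L : ℝ) ^ j / (L : ℝ) ^ k) ^ (d + 1)) :=
        mul_le_mul_of_nonneg_left hsum (mul_nonneg hC (Real.rpow_nonneg hspos.le _))
    _ = C * c368 d δ₀ * ((L : ℝ) ^ j * eps L k) ^ (e + ((d + 1 : ℕ) : ℝ)) := by
        rw [← hs, ← Real.rpow_natCast ((L : ℝ) ^ j * eps L k) (d + 1), Real.rpow_add hspos]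
        unfold c368
        ring

/-- ★ **PROPOSITION 3.7 SUMMED OVER ONE VERTEX**: for the `k`-level datum with `Prop37PrintedAt α D C δ₀` and every slice `j + 1 ≤ k`, kind `κ`, base point
`x`: `Σ_y η^{d+1}·|sliceLine D j κ x y| ≤ C·c368·(L^jη)^{lineDeg κ}` — the one-line subgraph's size with «altogether the exponent D(H₁)» = `lineDeg κ`.
[cite: King1986, Prop. 3.7 (3.63) p.663, (3.68) p.664] -/
theorem lineSum_sliceLine_le (hL : 1 ≤ L) {a msq : ℝ} {k eM : ℕ} (hk : 1 ≤ k) (M : Fin (d + 1) → ℕ) [∀ μ, NeZero (M μ)]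
    (hM : ∀ μ, M μ = 2 * L ^ eM) {α C δ₀ : ℝ} (hC : 0 ≤ C) (hδ₀ : 0 < δ₀)
    (h37 : Prop37PrintedAt α (kingSliceKernels L k eM M hM hk a msq) C δ₀)
    {j : ℕ} (hj : j + 1 ≤ k) (κ : Option (Fin (d + 1))) (x : Tor (fine (L ^ k) M)) :
    ∑ y : Tor (fine (L ^ k) M), (((L : ℝ) ^ k)⁻¹) ^ (d + 1) * |sliceLine (kingSliceKernels L k eM M hM hk a msq) j κ x y|
      ≤ C * c368 d δ₀ * ((L : ℝ) ^ j * eps L k) ^ lineDeg (d + 1) κ := by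
  obtain ⟨h1, -, -⟩ := h37 j hj
  have hpt : ∀ y, |sliceLine (kingSliceKernels L k eM M hM hk a msq) j κ x y|
      ≤ C * ((L : ℝ) ^ j * eps L k) ^ lineExp (d + 1) κ
          * Real.exp (-(δ₀ * ((L : ℝ) ^ j * eps L k)⁻¹ * (tdistT (fine (L ^ k) M) x y / (L : ℝ) ^ k))) := by
    intro y
    rcases κ with _ | μ
    · exact (h1 x y).1
    · exact (h1 x y).2 μ
  calc ∑ y : Tor (fine (L ^ k) M), (((L : ℝ) ^ k)⁻¹) ^ (d + 1) * |sliceLine (kingSliceKernels L k eM M hM hk a msq) j κ x y|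
      ≤ ∑ y : Tor (fine (L ^ k) M), (((L : ℝ) ^ k)⁻¹) ^ (d + 1) * (C * ((L : ℝ) ^ j * eps L k) ^ lineExp (d + 1) κ
          * Real.exp (-(δ₀ * ((L : ℝ) ^ j * eps L k)⁻¹ * (tdistT (fine (L ^ k) M) x y / (L : ℝ) ^ k)))) :=
        sum_le_sum fun y _ => mul_le_mul_of_nonneg_left (hpt y) (by positivity)
    _ ≤ C * c368 d δ₀ * ((L : ℝ) ^ j * eps L k) ^ (lineExp (d + 1) κ + ((d + 1 : ℕ) : ℝ)) :=
        lineSum_profile_le L hL hC hδ₀ k j M (lineExp (d + 1) κ) x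
    _ = C * c368 d δ₀ * ((L : ℝ) ^ j * eps L k) ^ lineDeg (d + 1) κ := by rw [lineExp_add_dim]

/-- ★ **PROPOSITION 3.9 (3.73) SUMMED OVER ONE VERTEX, ACROSS THE TWO LATTICES**: for the two-spacing record `T` with `Prop39PrintedAt α T C δ₀ γ`, every slice
`j + 1 ≤ k`, kind `κ`, fine base point `x′`: `Σ_{y′} η′^{d+1}·|hiLine T j κ x′ y′ − loLine T j κ (pt x′) (pt y′)| ≤ L^{−γk}·C·c368·(L^jη)^{lineDeg κ − γ}` — the
fine vertex sum re-paired onto `T_η` (part Ι-b `sum_repaired`, `(L^n)^{d+1}η′^{d+1} = η^{d+1}`), then (3.68) with «the degree … reduced by γ».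
[cite: King1986, Prop. 3.9 (3.73) p.665, (3.68) p.664, p.665 («the degrees of some subgraphs have been reduced by γ»)] -/
theorem lineSum_sliceRate_le (hL : 2 ≤ L) {a msq : ℝ} {k n eM : ℕ} (hk : 1 ≤ k) (M : Fin (d + 1) → ℕ) [∀ μ, NeZero (M μ)]
    (hM : ∀ μ, M μ = 2 * L ^ eM) {α C δ₀ γ : ℝ} (hC : 0 ≤ C) (hδ₀ : 0 < δ₀)
    (h39 : Prop39PrintedAt α (kingSlicesTwoSpacing L k n eM M hM hk a msq) C δ₀ γ)
    {j : ℕ} (hj : j + 1 ≤ k) (κ : Option (Fin (d + 1))) (x' : Tor (fine (L ^ (k + n)) M)) :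
    ∑ y' : Tor (fine (L ^ (k + n)) M), (((L : ℝ) ^ (k + n))⁻¹) ^ (d + 1)
        * |hiLine (kingSlicesTwoSpacing L k n eM M hM hk a msq) j κ x' y'
            - loLine (kingSlicesTwoSpacing L k n eM M hM hk a msq) j κ (kingSlicePt L k n M x') (kingSlicePt L k n M y')|
      ≤ (L : ℝ) ^ (-(γ * k)) * (C * c368 d δ₀ * ((L : ℝ) ^ j * eps L k) ^ (lineDeg (d + 1) κ - γ)) := by
  have hL1 : 1 ≤ L := by omega
  have hL0 : (0 : ℝ) < L := by exact_mod_cast (show 0 < L by omega)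
  -- termwise: Prop. 3.9 (3.73) through part Η-b
  have hpt : ∀ y', |hiLine (kingSlicesTwoSpacing L k n eM M hM hk a msq) j κ x' y'
        - loLine (kingSlicesTwoSpacing L k n eM M hM hk a msq) j κ (kingSlicePt L k n M x') (kingSlicePt L k n M y')|
      ≤ rateProfile (kingSlicesTwoSpacing L k n eM M hM hk a msq) C δ₀ γ j κ (kingSlicePt L k n M x') (kingSlicePt L k n M y') := by
    intro y'
    have h := hiLine_sub_loLine_le_rateProfile (kingSlicesTwoSpacing L k n eM M hM hk a msq) h39 hj κ x' y'
    rwa [Real.norm_eq_abs] at h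
  -- the re-pairing data
  have hfib := card_filter_kingSlicePt L k n M
  have hw := king_weight_repair (d := d) L hL0 k n
  -- reading the rate profile in the torus' letters
  have hprof : ∀ y : Tor (fine (L ^ k) M),
      rateProfile (kingSlicesTwoSpacing L k n eM M hM hk a msq) C δ₀ γ j κ (kingSlicePt L k n M x') y
        = (L : ℝ) ^ (-(γ * k)) * (C * ((L : ℝ) ^ j * eps L k) ^ (lineExp (d + 1) κ - γ)
            * Real.exp (-(δ₀ * ((L : ℝ) ^ j * eps L k)⁻¹ * (tdistT (fine (L ^ k) M) (kingSlicePt L k n M x') y / (L : ℝ) ^ k)))) := by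
    intro y
    show C * (L : ℝ) ^ (-(γ * k)) * ((L : ℝ) ^ j * eps L k) ^ (lineExp (d + 1) κ - γ)
        * Real.exp (-(δ₀ * ((L : ℝ) ^ j * eps L k)⁻¹ * (tdistT (fine (L ^ k) M) (kingSlicePt L k n M x') y / (L : ℝ) ^ k))) = _
    ring
  calc ∑ y' : Tor (fine (L ^ (k + n)) M), (((L : ℝ) ^ (k + n))⁻¹) ^ (d + 1)
          * |hiLine (kingSlicesTwoSpacing L k n eM M hM hk a msq) j κ x' y'
              - loLine (kingSlicesTwoSpacing L k n eM M hM hk a msq) j κ (kingSlicePt L k n M x') (kingSlicePt L k n M y')|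
      ≤ ∑ y' : Tor (fine (L ^ (k + n)) M), (((L : ℝ) ^ (k + n))⁻¹) ^ (d + 1)
          * rateProfile (kingSlicesTwoSpacing L k n eM M hM hk a msq) C δ₀ γ j κ (kingSlicePt L k n M x') (kingSlicePt L k n M y') :=
        sum_le_sum fun y' _ => mul_le_mul_of_nonneg_left (hpt y') (by positivity)
    _ = ∑ y : Tor (fine (L ^ k) M), (((L : ℝ) ^ k)⁻¹) ^ (d + 1)
          * rateProfile (kingSlicesTwoSpacing L k n eM M hM hk a msq) C δ₀ γ j κ (kingSlicePt L k n M x') y :=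
        sum_repaired (𝕜 := ℝ) (kingSlicePt L k n M) hfib hw
          (fun y => rateProfile (kingSlicesTwoSpacing L k n eM M hM hk a msq) C δ₀ γ j κ (kingSlicePt L k n M x') y)
    _ = (L : ℝ) ^ (-(γ * k)) * ∑ y : Tor (fine (L ^ k) M), (((L : ℝ) ^ k)⁻¹) ^ (d + 1)
          * (C * ((L : ℝ) ^ j * eps L k) ^ (lineExp (d + 1) κ - γ)
            * Real.exp (-(δ₀ * ((L : ℝ) ^ j * eps L k)⁻¹ * (tdistT (fine (L ^ k) M) (kingSlicePt L k n M x') y / (L : ℝ) ^ k)))) := by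
        rw [mul_sum]
        refine sum_congr rfl fun y _ => ?_
        rw [hprof y]; ring
    _ ≤ (L : ℝ) ^ (-(γ * k)) * (C * c368 d δ₀ * ((L : ℝ) ^ j * eps L k) ^ (lineExp (d + 1) κ - γ + ((d + 1 : ℕ) : ℝ))) :=
        mul_le_mul_of_nonneg_left (lineSum_profile_le L hL1 hC hδ₀ k j M (lineExp (d + 1) κ - γ) (kingSlicePt L k n M x'))
          (Real.rpow_nonneg hL0.le _)
    _ = (L : ℝ) ^ (-(γ * k)) * (C * c368 d δ₀ * ((L : ℝ) ^ j * eps L k) ^ (lineDeg (d + 1) κ - γ)) := by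
        rw [show lineExp (d + 1) κ - γ + ((d + 1 : ℕ) : ℝ) = lineDeg (d + 1) κ - γ by rw [← lineExp_add_dim]; ring]

end OneVertex

/-! ## §4 The slice sums (3.69)–(3.70) -/

section SliceSums

omit [NeZero L] in
/-- the slice weight as a real power of `L`: `(L^jη)^D = L^{D(j − k)}`. [cite: King1986, (3.69) p.664] -/
theorem slice_rpow_eq (hL0 : (0 : ℝ) < L) (j k : ℕ) (D : ℝ) : ((L : ℝ) ^ j * eps L k) ^ D = (L : ℝ) ^ (D * ((j : ℝ) - k)) := by
  show ((L : ℝ) ^ j * ((L : ℝ) ^ k)⁻¹) ^ D = _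
  rw [← Real.rpow_natCast (L : ℝ) j, ← Real.rpow_natCast (L : ℝ) k, ← Real.rpow_neg hL0.le, ← Real.rpow_add hL0,
    ← Real.rpow_mul hL0.le]
  congr 1
  ring

omit [NeZero L] in
/-- **(3.69): THE SLICE SUM WITH A POSITIVE DEGREE** — `Σ_{j<k}(L^jη)^D ≤ (1 − L^{−D})^{−1}` for `D > 0`, `L ≥ 2`, `k ≥ 1` (part Μ `sliceWeight_sum_le`; King:
*«we can sum over j_{l(1)} ≤ j_{l(2)}, since D(H₁) > 0»*, *«The final sum over j is then bounded by C»*). [cite: King1986, (3.69)–(3.70) p.664] -/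
theorem sliceSum_le (hL : 2 ≤ L) {D : ℝ} (hD : 0 < D) {k : ℕ} (hk : 1 ≤ k) :
    ∑ j ∈ Finset.range k, ((L : ℝ) ^ j * eps L k) ^ D ≤ (1 - (L : ℝ) ^ (-D))⁻¹ := by
  have hL0 : (0 : ℝ) < L := by exact_mod_cast (show 0 < L by omega)
  obtain ⟨hx0, hx1, -⟩ := sliceBase_lt_one hL hD
  have h := sliceWeight_sum_le hx0 hx1 (K' := k) (i₂ := k - 1) (by omega)
  rw [show k - 1 + 1 = k by omega] at h
  calc ∑ j ∈ Finset.range k, ((L : ℝ) ^ j * eps L k) ^ D = ∑ j ∈ Finset.range k, ((L : ℝ) ^ (-D)) ^ (k - j) :=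
        sum_congr rfl fun j hj => by
          rw [slice_rpow_eq L hL0, sliceWeight_eq_rpow (show 0 < L by omega) D (le_of_lt (mem_range.1 hj))]
    _ ≤ (1 - (L : ℝ) ^ (-D))⁻¹ * ((L : ℝ) ^ (-D)) ^ (k - (k - 1)) := h
    _ ≤ (1 - (L : ℝ) ^ (-D))⁻¹ := mul_le_of_le_one_right (inv_nonneg.2 (by linarith)) (pow_le_one₀ hx0 hx1.le)

omit [NeZero L] in
/-- **(3.70): THE `S^c` SLICES OF THE FINE RUN** (`i < n`, King's `−n ≤ j < 0`, lengths `L^iη′` below the coarse spacing): `Σ_{i<n}(L^iη′)^D ≤ (1 − L^{−D})^{−1}·L^{−D(k+1)}`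
(`η′ = L^{−(k+n)}`, `n ≥ 1`; part Μ `sliceWeight_sum_le`) — a positive power of `η`. [cite: King1986, (3.60)–(3.61) p.663, (3.70) p.664] -/
theorem finestSum_le (hL : 2 ≤ L) {D : ℝ} (hD : 0 < D) (k : ℕ) {n : ℕ} (hn : 1 ≤ n) :
    ∑ i ∈ Finset.range n, ((L : ℝ) ^ i * eps L (k + n)) ^ D ≤ (1 - (L : ℝ) ^ (-D))⁻¹ * (L : ℝ) ^ (-(D * (k + 1 : ℕ))) := by
  have hL0 : (0 : ℝ) < L := by exact_mod_cast (show 0 < L by omega)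
  obtain ⟨hx0, hx1, hxpow⟩ := sliceBase_lt_one hL hD
  have h := sliceWeight_sum_le hx0 hx1 (K' := k + n) (i₂ := n - 1) (by omega)
  rw [show n - 1 + 1 = n by omega, show k + n - (n - 1) = k + 1 by omega, hxpow (k + 1)] at h
  calc ∑ i ∈ Finset.range n, ((L : ℝ) ^ i * eps L (k + n)) ^ D = ∑ i ∈ Finset.range n, ((L : ℝ) ^ (-D)) ^ (k + n - i) :=
        sum_congr rfl fun i hi => by
          rw [slice_rpow_eq L hL0, sliceWeight_eq_rpow (show 0 < L by omega) D (show i ≤ k + n by have := mem_range.1 hi; omega)]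
    _ ≤ (1 - (L : ℝ) ^ (-D))⁻¹ * (L : ℝ) ^ (-(D * (k + 1 : ℕ))) := h

omit [NeZero L] in
/-- `(1 − L^{−D})^{−1} ≤ 2` for `D ≥ 1`, `L ≥ 2`. [folklore] -/
theorem geomConst_le_two (hL : 2 ≤ L) {D : ℝ} (hD : 1 ≤ D) : (1 - (L : ℝ) ^ (-D))⁻¹ ≤ 2 := by
  have hL2 : (2 : ℝ) ≤ L := by exact_mod_cast hL
  have hL1 : (1 : ℝ) ≤ L := by linarith
  have h1 : (L : ℝ) ^ (-D) ≤ (L : ℝ) ^ (-(1 : ℝ)) := Real.rpow_le_rpow_of_exponent_le hL1 (by linarith)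
  have h2 : (L : ℝ) ^ (-(1 : ℝ)) = (L : ℝ)⁻¹ := Real.rpow_neg_one _
  have h3 : (L : ℝ)⁻¹ ≤ 2⁻¹ := by gcongr
  refine inv_le_of_inv_le₀ two_pos ?_
  linarith

omit [NeZero L] in
/-- `(1 − L^{−D′})^{−1} ≤ (1 − L^{−D})^{−1}` for `0 < D ≤ D′`, `L ≥ 2` (the geometric constant is antitone in the degree). [folklore] -/
theorem geomConst_mono (hL : 2 ≤ L) {D D' : ℝ} (hD : 0 < D) (hDD : D ≤ D') : (1 - (L : ℝ) ^ (-D'))⁻¹ ≤ (1 - (L : ℝ) ^ (-D))⁻¹ := by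
  have hL1 : (1 : ℝ) ≤ L := by exact_mod_cast (show 1 ≤ L by omega)
  obtain ⟨-, hx1, -⟩ := sliceBase_lt_one hL hD
  have h1 : (L : ℝ) ^ (-D') ≤ (L : ℝ) ^ (-D) := Real.rpow_le_rpow_of_exponent_le hL1 (by linarith)
  exact inv_anti₀ (by linarith) (by linarith)

end SliceSums

end Summit.QuantumFields.YangMills.BalabanUVNodes.N15KingModelRung.Curved

end
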